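import Literature.NumberTheory.Transcendental.DiazThm1FromCh8
import Literature.NumberTheory.Transcendental.PhilipponCriterionMain
import Literature.NumberTheory.Transcendental.NesterenkoEliminationProp47ValuesProofs
import Literature.NumberTheory.Transcendental.NesterenkoEliminationCor412Proofs
import Literature.NumberTheory.Transcendental.PhilipponZeroEstimateP1nProofs
import Literature.NumberTheory.Transcendental.DiazThm1Unconditional
import Literature.NumberTheory.Transcendental.NesterenkoEliminationProp44Holds
import Literature.NumberTheory.Transcendental.NesterenkoEliminationProp413Proofs
import HarnessLib

/-!
# Diaz 1989, Corollaire 1 (`Diaz1989_cor1`): the remaining trust base — proofs only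

Topic `Literature/NumberTheory/Transcendental`. Proofs-only sibling of `DiazMain.lean` for the
named fact `Literature.NumberTheory.Transcendental.Diaz1989_cor1` — G. Diaz, *Grands degrés de
transcendance pour des familles d'exponentielles*, J. Number Theory 31 (1989) 1–23, Corollaire 1
(p. 3): for `a ∈ ℂ` non-zero with a non-zero logarithm `l` and `β` algebraic of degree `d ≥ 2`,
`trdeg_ℚ ℚ(a^β⁰, a^β, …, a^{β^{d-1}}) ≥ [(d+1)/2]` (`a^{β^k} := e^{β^k l}`). No definition, no
named fact is introduced here; nothing is asserted.

The deduction of Corollaire 1 from Diaz's Théorème 1 (`Diaz1989_cor1_of_thm1`,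
`DiazLadderProofs.lean`: Théorème 1 with `m = n = d`, `uᵢ = βⁱ⁻¹ l`, `vⱼ = βʲ⁻¹`, Liouville's
inequality supplying (HT1)) and of Théorème 1 from Philippon's criterion and Diaz's zero lemma
(`Diaz1989_thm1_of_criterion`, `DiazThm1Proofs.lean`; `Diaz1989_thm1_of_ch8`,
`DiazThm1FromCh8.lean`) are in the tree. Since Philippon's zero estimate on `𝔾ₐ × 𝔾ₘⁿ ⊂ (ℙ¹)ⁿ⁺¹`
is now PROVED (`Philippon1986_GaGm_P1n_holds`, `PhilipponZeroEstimateP1nProofs.lean`), whence the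
zero lemma (`Diaz1989_zeroLemma_of_P1n`), and Philippon's criterion `Philippon1986_mainCriterion`
is derived from the named facts of LNM 1752 Ch. 3 §4 (`Philippon1986_mainCriterion_of_nesterenko'`,
`PhilipponCriterionMain.lean`, Cor. 4.10 discharged) with Prop. 4.7 itself derived from Prop. 4.4
(`NesterenkoPhilippon2001_ch3_prop_4_7_of_prop_4_4`, `NesterenkoEliminationProp47ValuesProofs.lean`),
this file records what is LEFT, as proved implications with clean axioms:

* `Philippon1986_mainCriterion_of_nesterenko''` — Philippon's criterion (Publ. Math. IHÉS 64
  (1986), Thm 2.11, transcendence-degree form) from FOUR facts of LNM 1752 Ch. 3 §4: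
  Prop. 4.4, Prop. 4.11, Cor. 4.12, Prop. 4.13;
* `Diaz1989_thm1_of_nesterenko`, `Diaz1989_cor1_of_nesterenko` — Diaz's Théorème 1 and
  Corollaire 1 from the same four facts and nothing else;
* `Diaz1989_thm1_of_ch8_cor_1_1`, `Diaz1989_cor1_of_ch8_cor_1_1` — the alternative route: Théorème 1
  and Corollaire 1 from the single named fact `NesterenkoPhilippon2001_ch8_cor_1_1` (LNM 1752 Ch. 8
  Cor. 1.1, Philippon's criterion in the editors' form).

The discharge `Diaz1989_cor1_holds` is `Diaz1989_cor1_of_nesterenko` (resp. `_of_ch8_cor_1_1`)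
applied to the discharges of those facts, to be appended here once they land.

Second instalment (Cor. 4.12 being now DERIVED from Prop. 4.11,
`NesterenkoPhilippon2001_ch3_cor_4_12_of_prop_4_11`, `NesterenkoEliminationCor412Proofs.lean`, and
Théorème 1 being PROVED in the range `[(mn+m)/(m+n)] ≤ 2`, `Diaz1989_thm1_midRange`,
`DiazThm1Unconditional.lean`):

* `Diaz1989_thm1_of_nesterenko'`, `Diaz1989_cor1_of_nesterenko'` — Théorème 1 and Corollaire 1
  from THREE facts of LNM 1752 Ch. 3 §4: Prop. 4.4, Prop. 4.11, Prop. 4.13 (the current trust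
  base);
* `Diaz1989_cor1_of_diag` — the deduction Théorème 1 ⇒ Corollaire 1 run on the single instance of
  Théorème 1 it uses (`m = n = d`, `uᵢ = βⁱ l`, `vⱼ = βʲ`), with no measure of linear independence
  in the hypothesis;
* `Diaz1989_cor1_smallDegree` — **Corollaire 1 for `d ≤ 4`, PROVED unconditionally**: for
  `l ≠ 0` and `β` algebraic of degree `d ∈ {2, 3, 4}`, `trdeg_ℚ ℚ(e^{β^k l} ; k < d) ≥ [(d+1)/2]`
  (`= 1, 2, 2`); for `d = 3` and `a = e^l` algebraic this is Gel'fond's 1949 theorem (`a^β`,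
  `a^{β²}` algebraically independent for cubic `β`), here obtained from LNM 1752 Ch. 13
  Thm 3.1 (ii) (`Laurent2001_thm_3_1_ii_holds`) through `Diaz1989_thm1_midRange`
  (`d² + d < 6d ⟺ d ≤ 4`);
* `Diaz1989_cor1_of_thm1_largeRange`, `Diaz1989_cor1_of_degree_five_le` — what is left of
  Corollaire 1: it follows from Théorème 1 restricted to the range `3(m+n) ≤ mn + m`, and it is
  equivalent to its own restriction to `d ≥ 5`.

Third instalment (Prop. 4.4 being now DISCHARGED, `NesterenkoPhilippon2001_ch3_prop_4_4_holds`,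
`NesterenkoEliminationProp44Holds.lean`, and Prop. 4.13 DERIVED from Prop. 4.4,
`NesterenkoPhilippon2001_ch3_prop_4_13_of_prop_4_4`, `NesterenkoEliminationProp413Proofs.lean`):

* `Philippon1986_mainCriterion_of_prop_4_11`, `Diaz1989_thm1_of_prop_4_11`,
  `Diaz1989_cor1_of_prop_4_11` — Philippon's criterion, Diaz's Théorème 1 and Corollaire 1 from the
  SINGLE named fact `NesterenkoPhilippon2001_ch3_prop_4_11` (LNM 1752 Ch. 3 Prop. 4.11, the metric
  Bézout step), which is therefore the whole remaining trust base of `Diaz1989_cor1`; the discharge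
  `Diaz1989_cor1_holds := Diaz1989_cor1_of_prop_4_11 …prop_4_11_holds` is to be appended here.

## References

* [Diaz1989] G. Diaz, *Grands degrés de transcendance pour des familles d'exponentielles*,
  J. Number Theory 31 (1989) 1–23, Théorème 1 (pp. 1–2), Corollaire 1 (p. 3).
* [Philippon1986Criteres] P. Philippon, *Critères pour l'indépendance algébrique*, Publ. Math.
  IHÉS 64 (1986) 5–52, Thm 2.11.
* [Philippon1986] P. Philippon, *Lemmes de zéros dans les groupes algébriques commutatifs*,
  Bull. Soc. Math. France 114 (1986) 355–383, Thm 2.1.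
* [NesterenkoPhilippon2001] Yu. V. Nesterenko, P. Philippon (eds.), *Introduction to algebraic
  independence theory*, LNM 1752 (2001), Ch. 3 §4 (Prop. 4.4, 4.11, Cor. 4.12, Prop. 4.13),
  Ch. 8 Cor. 1.1, Ch. 13 Thm 3.1 (ii), Ch. 14 Thm 2.7 and Cor. 2.8 (pp. 248–249).
* [Gelfond1949] A. O. Gel'fond, *The approximation of algebraic numbers by algebraic numbers and
  the theory of transcendental numbers*, Uspekhi Mat. Nauk 4 (1949), no. 4, 19–49 (AMS Transl. 65):
  algebraic independence of `a^β`, `a^{β²}` for cubic `β` (the case `d = 3` of Corollaire 1 with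
  `a` algebraic).
-/

noncomputable section

namespace Literature.NumberTheory.Transcendental

open Nesterenko

/-- **Philippon's main criterion from four facts of LNM 1752 Ch. 3 §4** (Prop. 4.4, Prop. 4.11,
Cor. 4.12, Prop. 4.13): `Philippon1986_mainCriterion_of_nesterenko'` with Prop. 4.7 supplied by
`NesterenkoPhilippon2001_ch3_prop_4_7_of_prop_4_4` (and Cor. 4.10 by its discharge).
[cite: Philippon1986Criteres, Théorème 2.11 and §3]
[cite: NesterenkoPhilippon2001, Ch. 3 §4, Prop. 4.4, Prop. 4.11, Cor. 4.12, Prop. 4.13] -/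
theorem Philippon1986_mainCriterion_of_nesterenko''
    (h44 : NesterenkoPhilippon2001_ch3_prop_4_4) (h411 : NesterenkoPhilippon2001_ch3_prop_4_11)
    (h412 : NesterenkoPhilippon2001_ch3_cor_4_12) (h413 : NesterenkoPhilippon2001_ch3_prop_4_13) :
    Philippon1986_mainCriterion :=
  Philippon1986_mainCriterion_of_nesterenko' h44
    (NesterenkoPhilippon2001_ch3_prop_4_7_of_prop_4_4 h44) h411 h412 h413

/-- **Diaz 1989, Théorème 1, from four facts of LNM 1752 Ch. 3 §4** (Prop. 4.4, Prop. 4.11,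
Cor. 4.12, Prop. 4.13) — Philippon's zero estimate being proved (`Philippon1986_GaGm_P1n_holds`).
[cite: Diaz1989, Théorème 1, pp. 1–2] -/
theorem Diaz1989_thm1_of_nesterenko
    (h44 : NesterenkoPhilippon2001_ch3_prop_4_4) (h411 : NesterenkoPhilippon2001_ch3_prop_4_11)
    (h412 : NesterenkoPhilippon2001_ch3_cor_4_12) (h413 : NesterenkoPhilippon2001_ch3_prop_4_13) :
    Diaz1989_thm1 :=
  Diaz1989_thm1_of_philippon (Philippon1986_mainCriterion_of_nesterenko'' h44 h411 h412 h413)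
    Philippon1986_GaGm_P1n_holds

/-- **Diaz 1989, Corollaire 1, from four facts of LNM 1752 Ch. 3 §4** (Prop. 4.4, Prop. 4.11,
Cor. 4.12, Prop. 4.13): for `a ∈ ℂ ∖ 0` with a non-zero logarithm `l`, `β` algebraic of degree
`d ≥ 2`, `trdeg_ℚ ℚ(e^{β^k l} ; k < d) ≥ [(d+1)/2]`. This is the whole remaining trust base of
`Diaz1989_cor1` (Philippon's zero estimate, Diaz's zero lemma, Cor. 4.9, Cor. 4.10, Prop. 4.7 ⇐ 4.4,
Théorème 1 ⇒ Corollaire 1 all being proved in the tree).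
[cite: Diaz1989, Corollaire 1, p. 3] -/
theorem Diaz1989_cor1_of_nesterenko
    (h44 : NesterenkoPhilippon2001_ch3_prop_4_4) (h411 : NesterenkoPhilippon2001_ch3_prop_4_11)
    (h412 : NesterenkoPhilippon2001_ch3_cor_4_12) (h413 : NesterenkoPhilippon2001_ch3_prop_4_13) :
    Diaz1989_cor1 :=
  Diaz1989_cor1_of_thm1 (Diaz1989_thm1_of_nesterenko h44 h411 h412 h413)

/-- **Diaz 1989, Théorème 1, from LNM 1752 Ch. 8 Cor. 1.1 alone** (`Diaz1989_thm1_of_ch8_P1n` with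
Philippon's zero estimate discharged). [cite: Diaz1989, Théorème 1, pp. 1–2]
[cite: NesterenkoPhilippon2001, Ch. 8 Cor. 1.1] -/
theorem Diaz1989_thm1_of_ch8_cor_1_1 (hC : NesterenkoPhilippon2001_ch8_cor_1_1) : Diaz1989_thm1 :=
  Diaz1989_thm1_of_ch8_P1n hC Philippon1986_GaGm_P1n_holds

/-- **Diaz 1989, Corollaire 1, from LNM 1752 Ch. 8 Cor. 1.1 alone** (`Diaz1989_cor1_of_ch8_P1n` with
Philippon's zero estimate discharged). [cite: Diaz1989, Corollaire 1, p. 3]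
[cite: NesterenkoPhilippon2001, Ch. 8 Cor. 1.1] -/
theorem Diaz1989_cor1_of_ch8_cor_1_1 (hC : NesterenkoPhilippon2001_ch8_cor_1_1) : Diaz1989_cor1 :=
  Diaz1989_cor1_of_ch8_P1n hC Philippon1986_GaGm_P1n_holds

/-! ### Second instalment: three facts; the diagonal instance; small degrees unconditionally -/

/-- **Diaz 1989, Théorème 1, from three facts of LNM 1752 Ch. 3 §4** (Prop. 4.4, Prop. 4.11,
Prop. 4.13): `Diaz1989_thm1_of_nesterenko` with Cor. 4.12 supplied by
`NesterenkoPhilippon2001_ch3_cor_4_12_of_prop_4_11`. [cite: Diaz1989, Théorème 1, pp. 1–2]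
[cite: NesterenkoPhilippon2001, Ch. 3 §4, Prop. 4.4, Prop. 4.11, Prop. 4.13] -/
theorem Diaz1989_thm1_of_nesterenko'
    (h44 : NesterenkoPhilippon2001_ch3_prop_4_4) (h411 : NesterenkoPhilippon2001_ch3_prop_4_11)
    (h413 : NesterenkoPhilippon2001_ch3_prop_4_13) : Diaz1989_thm1 :=
  Diaz1989_thm1_of_nesterenko h44 h411 (NesterenkoPhilippon2001_ch3_cor_4_12_of_prop_4_11 h411) h413

/-- **Diaz 1989, Corollaire 1, from three facts of LNM 1752 Ch. 3 §4** (Prop. 4.4, Prop. 4.11,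
Prop. 4.13) — the current trust base of `Diaz1989_cor1`. [cite: Diaz1989, Corollaire 1, p. 3]
[cite: NesterenkoPhilippon2001, Ch. 3 §4, Prop. 4.4, Prop. 4.11, Prop. 4.13] -/
theorem Diaz1989_cor1_of_nesterenko'
    (h44 : NesterenkoPhilippon2001_ch3_prop_4_4) (h411 : NesterenkoPhilippon2001_ch3_prop_4_11)
    (h413 : NesterenkoPhilippon2001_ch3_prop_4_13) : Diaz1989_cor1 :=
  Diaz1989_cor1_of_thm1 (Diaz1989_thm1_of_nesterenko' h44 h411 h413)

/-- **Corollaire 1 from the diagonal instance of Théorème 1** (Diaz 1989, p. 3; LNM 1752 Ch. 14,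
proof of Cor. 2.8, p. 249): for `β` algebraic of degree `d ≥ 1` and any `l`, if the conclusion of
Théorème 1 holds for `m = n = d`, `uᵢ = βⁱ l`, `vⱼ = βʲ` (`0 ≤ i, j < d`) — i.e.
`trdeg_ℚ ℚ(βʲ, e^{βⁱ⁺ʲ l}) ≥ [(d² + d)/2d]` — then `trdeg_ℚ ℚ(e^{β^k l} ; k < d) ≥ [(d+1)/2]`:
`[(d²+d)/2d] = [(d+1)/2]`, and `ℚ(βʲ, e^{βⁱ⁺ʲ l})` is algebraic over `ℚ(e^{β^k l} ; k < d)`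
(`β` is algebraic and `β^{i+j}` is a `ℚ`-combination of `1, β, …, β^{d-1}`;
`trdeg_gridField_le'`). [cite: Diaz1989, Corollaire 1, p. 3]
[cite: NesterenkoPhilippon2001, Ch. 14 Cor. 2.8 (proof), p. 249] -/
theorem Diaz1989_cor1_of_diag {β l : ℂ} {d : ℕ} (hd : (minpoly ℚ β).natDegree = d) (h1 : 1 ≤ d)
    (H : (((d * d + d) / (d + d) : ℕ) : Cardinal) ≤ Algebra.trdeg ℚ
      ↥(IntermediateField.adjoin ℚ (Set.range (fun j : Fin d => β ^ (j : ℕ)) ∪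
        Set.range fun p : Fin d × Fin d => Complex.exp ((β ^ (p.1 : ℕ) * l) * β ^ (p.2 : ℕ))))) :
    (((d + 1) / 2 : ℕ) : Cardinal) ≤ Algebra.trdeg ℚ
      ↥(IntermediateField.adjoin ℚ (Set.range fun k : Fin d => Complex.exp (β ^ (k : ℕ) * l))) := by
  have e1 : d * d + d = d * (d + 1) := by ring
  rw [e1, grid_exponent_eq d (by omega)] at H
  set K := IntermediateField.adjoin ℚ (Set.range fun p : Fin d × Fin d =>
    Complex.exp (β ^ (p.1 : ℕ) * (β ^ (p.2 : ℕ) * l))) with hK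
  refine (H.trans (DiazMain.trdeg_mono ?_)).trans (trdeg_gridField_le' hd h1 K le_rfl)
  refine IntermediateField.adjoin_le_iff.mpr ?_
  rintro z (⟨j, rfl⟩ | ⟨p, rfl⟩)
  · exact IntermediateField.subset_adjoin ℚ _ (Set.mem_union_right _ ⟨j, rfl⟩)
  · refine IntermediateField.subset_adjoin ℚ _ (Set.mem_union_left _ ?_)
    show Complex.exp ((β ^ (p.1 : ℕ) * l) * β ^ (p.2 : ℕ)) ∈ (K : Set ℂ)
    have e2 : (β ^ (p.1 : ℕ) * l) * β ^ (p.2 : ℕ) = β ^ (p.2 : ℕ) * (β ^ (p.1 : ℕ) * l) := by ring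
    rw [e2]
    exact IntermediateField.subset_adjoin ℚ _ ⟨(p.2, p.1), rfl⟩

/-- **Diaz 1989, Corollaire 1 for `d ≤ 4`, PROVED** (no hypothesis beyond the data): for `l ≠ 0`
and `β` algebraic of degree `d` with `2 ≤ d ≤ 4`, `trdeg_ℚ ℚ(e^l, e^{βl}, …, e^{β^{d-1}l}) ≥ [(d+1)/2]`;
with `a := e^l` (any non-zero `a` with a non-zero logarithm `l`, `a^{β^k} := e^{β^k l}`): among
`a, a^β, …, a^{β^{d-1}}` at least `[(d+1)/2]` are algebraically independent. The instance
`m = n = d`, `uᵢ = βⁱ l`, `vⱼ = βʲ` of Théorème 1 lies in the range `[(mn+m)/(m+n)] ≤ 2` exactly when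
`d² + d < 6d`, i.e. `d ≤ 4`, where Théorème 1 is proved for all `ℚ`-linearly independent families
(`Diaz1989_thm1_midRange`: Gelfond–Schneider and LNM 1752 Ch. 13 Thm 3.1 (ii)); both families are
`ℚ`-linearly independent because `1, β, …, β^{d-1}` are and `l ≠ 0`. The case `d = 3`, `a`
algebraic, is Gel'fond's theorem (1949) on the algebraic independence of `a^β` and `a^{β²}` for
cubic irrational `β`. [cite: Diaz1989, Corollaire 1, p. 3]
[cite: NesterenkoPhilippon2001, Ch. 13 Thm 3.1 (ii); Ch. 14 Cor. 2.8, p. 249]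
[cite: Gelfond1949] -/
theorem Diaz1989_cor1_smallDegree (β l : ℂ) (d : ℕ) (hd : (minpoly ℚ β).natDegree = d)
    (h2 : 2 ≤ d) (h4 : d ≤ 4) (hl : l ≠ 0) :
    (((d + 1) / 2 : ℕ) : Cardinal) ≤ Algebra.trdeg ℚ
      ↥(IntermediateField.adjoin ℚ (Set.range fun k : Fin d => Complex.exp (β ^ (k : ℕ) * l))) := by
  set x : Fin d → ℂ := fun j => β ^ (j : ℕ) with hx
  set y : Fin d → ℂ := fun i => β ^ (i : ℕ) * l with hy
  have hxli : LinearIndependent ℚ x := by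
    have := linearIndependent_pow (K := ℚ) β
    rwa [hd] at this
  have hyli : LinearIndependent ℚ y :=
    hxli.map' (LinearMap.mulRight ℚ l) (LinearMap.ker_eq_bot.mpr (mul_left_injective₀ hl))
  have hmid : d * d + d < 3 * (d + d) := by nlinarith
  exact Diaz1989_cor1_of_diag hd (by omega) (Diaz1989_thm1_midRange d d y x hyli hxli (by omega) h2 hmid)

/-- **Corollaire 1 from Théorème 1 restricted to the range `3(m+n) ≤ mn + m`** (the only range of
Théorème 1 not yet proved in the tree, `Diaz1989_thm1_of_range_three_le`).
[cite: Diaz1989, Théorème 1 (pp. 1–2) and Corollaire 1 (p. 3)] -/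
theorem Diaz1989_cor1_of_thm1_largeRange
    (H : ∀ (n m : ℕ) (u : Fin n → ℂ) (v : Fin m → ℂ),
      LinearIndependent ℚ u → LinearIndependent ℚ v →
      Diaz1989.MeasureA u ((m * (n + 1) : ℝ) / (2 * m + n)) →
      Diaz1989.MeasureB v ((m * (n + 1) : ℝ) / (m + 2 * n + 1)) →
      1 ≤ n → 2 ≤ m → 3 * (m + n) ≤ m * n + m →
        (((m * n + m) / (m + n) : ℕ) : Cardinal) ≤ Algebra.trdeg ℚ
          ↥(IntermediateField.adjoin ℚ (Set.range v ∪
            Set.range fun p : Fin n × Fin m => Complex.exp (u p.1 * v p.2)))) :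
    Diaz1989_cor1 :=
  Diaz1989_cor1_of_thm1 (Diaz1989_thm1_of_range_three_le H)

/-- **`Diaz1989_cor1` reduces to degrees `d ≥ 5`**: Corollaire 1 follows from its restriction to
`β` of degree `d ≥ 5` (the degrees `2 ≤ d ≤ 4` being proved, `Diaz1989_cor1_smallDegree`).
[cite: Diaz1989, Corollaire 1, p. 3] -/
theorem Diaz1989_cor1_of_degree_five_le
    (H : ∀ (a β l : ℂ) (d : ℕ), (minpoly ℚ β).natDegree = d → 5 ≤ d → Complex.exp l = a → l ≠ 0 →
      (((d + 1) / 2 : ℕ) : Cardinal) ≤ Algebra.trdeg ℚ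
        ↥(IntermediateField.adjoin ℚ (Set.range fun k : Fin d => Complex.exp (β ^ (k : ℕ) * l)))) :
    Diaz1989_cor1 := by
  intro a β l d hd h2 hexp hl
  rcases Nat.lt_or_ge d 5 with h4 | h5
  · exact Diaz1989_cor1_smallDegree β l d hd h2 (by omega) hl
  · exact H a β l d hd h5 hexp hl

/-- **`Diaz1989_cor1` is equivalent to its restriction to degrees `d ≥ 5`.**
[cite: Diaz1989, Corollaire 1, p. 3] -/
theorem Diaz1989_cor1_iff_degree_five_le :
    Diaz1989_cor1 ↔
      ∀ (a β l : ℂ) (d : ℕ), (minpoly ℚ β).natDegree = d → 5 ≤ d → Complex.exp l = a → l ≠ 0 →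
        (((d + 1) / 2 : ℕ) : Cardinal) ≤ Algebra.trdeg ℚ
          ↥(IntermediateField.adjoin ℚ (Set.range fun k : Fin d => Complex.exp (β ^ (k : ℕ) * l))) :=
  ⟨fun h a β l d hd h5 hexp hl => h a β l d hd (by omega) hexp hl, Diaz1989_cor1_of_degree_five_le⟩

/-! ### Third instalment: one fact left (LNM 1752 Ch. 3 Prop. 4.11) -/

/-- **Philippon's main criterion from LNM 1752 Ch. 3 Prop. 4.11 alone**:
`Philippon1986_mainCriterion_of_nesterenko''` with Prop. 4.4 supplied by its discharge
`NesterenkoPhilippon2001_ch3_prop_4_4_holds`, Cor. 4.12 by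
`NesterenkoPhilippon2001_ch3_cor_4_12_of_prop_4_11` and Prop. 4.13 by
`NesterenkoPhilippon2001_ch3_prop_4_13_of_prop_4_4`. [cite: Philippon1986Criteres, Théorème 2.11 and §3]
[cite: NesterenkoPhilippon2001, Ch. 3 §4, Prop. 4.11 (pp. 40–41)] -/
theorem Philippon1986_mainCriterion_of_prop_4_11 (h411 : NesterenkoPhilippon2001_ch3_prop_4_11) :
    Philippon1986_mainCriterion :=
  Philippon1986_mainCriterion_of_nesterenko'' NesterenkoPhilippon2001_ch3_prop_4_4_holds h411
    (NesterenkoPhilippon2001_ch3_cor_4_12_of_prop_4_11 h411)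
    (NesterenkoPhilippon2001_ch3_prop_4_13_of_prop_4_4 NesterenkoPhilippon2001_ch3_prop_4_4_holds)

/-- **Diaz 1989, Théorème 1, from LNM 1752 Ch. 3 Prop. 4.11 alone** (`Diaz1989_thm1_of_nesterenko'`
with Prop. 4.4 discharged and Prop. 4.13 derived from it). [cite: Diaz1989, Théorème 1, pp. 1–2]
[cite: NesterenkoPhilippon2001, Ch. 3 §4, Prop. 4.11 (pp. 40–41)] -/
theorem Diaz1989_thm1_of_prop_4_11 (h411 : NesterenkoPhilippon2001_ch3_prop_4_11) : Diaz1989_thm1 :=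
  Diaz1989_thm1_of_nesterenko' NesterenkoPhilippon2001_ch3_prop_4_4_holds h411
    (NesterenkoPhilippon2001_ch3_prop_4_13_of_prop_4_4 NesterenkoPhilippon2001_ch3_prop_4_4_holds)

/-- **Diaz 1989, Corollaire 1, from LNM 1752 Ch. 3 Prop. 4.11 alone** — the whole remaining trust
base of `Diaz1989_cor1`: for `a ∈ ℂ ∖ 0` with a non-zero logarithm `l` and `β` algebraic of degree
`d ≥ 2`, `trdeg_ℚ ℚ(e^{β^k l} ; k < d) ≥ [(d+1)/2]`, granted the metric Bézout step Prop. 4.11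
(everything else — Philippon's zero estimate, Diaz's zero lemma, Prop. 4.4, 4.7, 4.8, Cor. 4.9, 4.10,
4.12, Prop. 4.13, Philippon's criterion from these, Théorème 1 ⇒ Corollaire 1 — being proved in the
tree). [cite: Diaz1989, Corollaire 1, p. 3]
[cite: NesterenkoPhilippon2001, Ch. 3 §4, Prop. 4.11 (pp. 40–41)] -/
theorem Diaz1989_cor1_of_prop_4_11 (h411 : NesterenkoPhilippon2001_ch3_prop_4_11) : Diaz1989_cor1 :=
  Diaz1989_cor1_of_thm1 (Diaz1989_thm1_of_prop_4_11 h411)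

end Literature.NumberTheory.Transcendental

end
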